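import Literature.NumberTheory.ConnesMoscovici2022.UVProlateSpectrum
import Mathlib.Analysis.SpecialFunctions.Integrability.Basic

/-!
# RH-FREE. Connes–Moscovici 2022, §1: one-sided limits at the regular singular points `±λ` for
# general elements of `dom W_max` under the boundary condition `p ∂ξ → 0` (inhomogeneous version)

LINE 1 FRAMING: RH-FREE corpus literature (cell rh-crit, C1 Connes–Consani/Moscovici corpus, row O2
`UVProlateSpectrum`; one-dimensional regular-singular-endpoint bookkeeping for the prolate wave operator
`W_λ = −∂ₓ(λ² − x²)∂ₓ + (2πλx)²`).  bears_on: W-C/W-P only (sequel material, no leaf role).  WHAT THIS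
IS NOT: nothing here bears on the truth of RH; no statement about zeta zeros; theorems only (0 defs,
0 named facts).

## What is proved — step (α) of the cell's plan for `CM22_thm_1_6` (ii)–(iv) / `CM22_lemma_1_5`

The tree's `UVProlateEigenfunctionEndpoint.exists_tendsto_nhdsGT_of_singular_endpoint` (seat t14) gives
the one-sided limit of an EIGENFUNCTION representative at `λ` from the HOMOGENEOUS equation
`(p g′)′ = r g`.  For a GENERAL `ξ ∈ dom W_max` the equation is inhomogeneous, `(p g′)′ = q g − η` with
`η = W_max ξ ∈ L²` only, so it holds in integrated (FTC) form — exactly the shape exported by the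
companion module `UVProlateMaxDomainRegularity.exists_regular_repr`.  This file proves the limit
lemmas in that shape:

* `intervalIntegral_norm_le_sqrt` — `∫_a^x ‖f‖ ≤ (1 + ‖f‖²_{L²(a,b)})/2 · √(x − a)` for `f ∈ L²(a,b)`
  (AM–GM with `δ = (x−a)^{-1/2}`, as in t14's file; no Hölder), and its mirror;
* `exists_tendsto_nhdsGT_of_norm_deriv_le` / `…nhdsLT…` — `g ∈ C¹(a,b)` with
  `‖g′(x)‖ ≤ C/√(x−a)` has a limit at `a⁺` (resp. `‖g′‖ ≤ C/√(b−x)` ⇒ limit at `b⁻`);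
* `exists_tendsto_nhdsGT_of_ftc` / `exists_tendsto_nhdsLT_of_ftc` — if `p(y)g′(y) − p(x)g′(x) =
  ∫_x^y f` on `(a,b)` with `f ∈ L²(a,b)`, `‖p(x)‖ ≥ m·dist(x, endpoint)` and `p g′ → 0` at the endpoint
  (the boundary condition (1.19) `lim (λ² − x²)∂ₓξ = 0`), then `g` has a limit at that endpoint
  (`p g′(x) = ∫_a^x f = O(√(x−a))`, so `g′ = O((x−a)^{-1/2})` is integrable);
* `exists_tendsto_right_lam_of_ftc` / `…left_lam…` / `…right_neg_lam…` / `…left_neg_lam…` — the four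
  instantiations for `p = λ² − x²`, `f = q g − η` with `g =ᵐ ξ ∈ L²(ℝ)`, `η ∈ L²(ℝ)`, in the binder shape
  of `exists_regular_repr` (so that for `ξ ∈ dom W_sa`, whose representative satisfies (1.19), the
  representative is continuous up to `±λ` from each side — the input «(α)» of the Green-identity steps
  (β)/(γ) towards Thm 1.6 (ii)–(iv) recorded on the cell board).

Printed source of the mechanism: [ConnesMoscovici2022] = arXiv:2112.05500v1, proof of Lemma 2.2
(chunk p0004:L72–L90: `p∂ξ = f₁ + s` with `f₁` the primitive of an `L² ⊂ L¹` function) and Cor 2.7 (i)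
(chunk p0006:L116–L123: regularity up to `λ`); the elementary estimate is folklore (Cauchy–Schwarz /
AM–GM).  Cell rh-crit seat cc-t6 g4.
-/

noncomputable section

open Complex Set MeasureTheory Filter Topology intervalIntegral
open scoped Real Topology ContDiff

namespace Literature.NumberTheory.ConnesMoscovici2022

/-! ## §A. `∫_a^x ‖f‖ = O(√(x − a))` for `f ∈ L²(a, b)` -/

section SqrtBound

variable {a b : ℝ} {f : ℝ → ℂ}

/-- AM–GM in the form `t ≤ (δ + t²/δ)/2` (`δ > 0`). [folklore] -/
private theorem le_half_add_sq_div' (t : ℝ) {δ : ℝ} (hδ : 0 < δ) : t ≤ (δ + t ^ 2 / δ) / 2 := by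
  have h : (δ + t ^ 2 / δ) / 2 = (δ ^ 2 + t ^ 2) / (2 * δ) := by
    field_simp
  rw [h, le_div_iff₀ (by positivity)]
  nlinarith [sq_nonneg (δ - t)]

/-- An `L²` function on a bounded interval is `L¹` there: `‖f‖ ≤ (1 + ‖f‖²)/2`.
[cite: ConnesMoscovici2022, proof of Lemma 1.2 (= arXiv Lemma 2.2, chunk p0004:L72: «belongs to L²(V) ⊂ L¹(V)»)] -/
theorem integrableOn_norm_of_sq (hfm : AEStronglyMeasurable f (volume.restrict (Ioo a b)))
    (hL2 : IntegrableOn (fun x ↦ ‖f x‖ ^ 2) (Ioo a b)) :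
    IntegrableOn (fun t ↦ ‖f t‖) (Ioo a b) := by
  have hc : IntegrableOn (fun _ : ℝ ↦ (1:ℝ)/2) (Ioo a b) volume :=
    integrableOn_const (measure_Ioo_lt_top (a := a) (b := b)).ne
  refine Integrable.mono' ((hL2.div_const 1).add hc) hfm.norm (ae_of_all _ fun t ↦ ?_)
  rw [Real.norm_eq_abs, abs_norm]
  simp only [Pi.add_apply, div_one]
  nlinarith [sq_nonneg (‖f t‖ - 1)]

/-- An `L²` function on a bounded interval is integrable there.
[cite: ConnesMoscovici2022, proof of Lemma 1.2 (= arXiv Lemma 2.2, chunk p0004:L72: «belongs to L²(V) ⊂ L¹(V)»)] -/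
theorem integrableOn_of_sq (hfm : AEStronglyMeasurable f (volume.restrict (Ioo a b)))
    (hL2 : IntegrableOn (fun x ↦ ‖f x‖ ^ 2) (Ioo a b)) :
    IntegrableOn f (Ioo a b) :=
  (integrable_norm_iff hfm).1 (integrableOn_norm_of_sq hfm hL2)

/-- `∫_a^x ‖f‖ ≤ (1 + ‖f‖²_{L²(a,b)})/2 · √(x − a)` for `f ∈ L²(a,b)` and `x ∈ (a,b)` (AM–GM with
`δ = (x−a)^{-1/2}`; no Hölder needed).
[cite: ConnesMoscovici2022, proof of Lemma 1.2 (= arXiv Lemma 2.2, chunk p0004:L72–L74)] -/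
theorem intervalIntegral_norm_le_sqrt (hfm : AEStronglyMeasurable f (volume.restrict (Ioo a b)))
    (hL2 : IntegrableOn (fun x ↦ ‖f x‖ ^ 2) (Ioo a b)) {x : ℝ} (hx : x ∈ Ioo a b) :
    ∫ t in a..x, ‖f t‖ ≤ (1 + ∫ t in Ioo a b, ‖f t‖ ^ 2) / 2 * Real.sqrt (x - a) := by
  have hax : a < x := hx.1
  have hxa : 0 < x - a := sub_pos.2 hax
  set N : ℝ := ∫ t in Ioo a b, ‖f t‖ ^ 2 with hN
  have hN0 : 0 ≤ N := setIntegral_nonneg measurableSet_Ioo fun t _ ↦ by positivity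
  set δ : ℝ := (Real.sqrt (x - a))⁻¹ with hδ
  have hsqrt : 0 < Real.sqrt (x - a) := Real.sqrt_pos.2 hxa
  have hδ0 : 0 < δ := inv_pos.2 hsqrt
  have hsub : Ioo a x ⊆ Ioo a b := Ioo_subset_Ioo_right hx.2.le
  have hL2x : IntervalIntegrable (fun t ↦ ‖f t‖ ^ 2) volume a x := by
    rw [intervalIntegrable_iff_integrableOn_Ioo_of_le hax.le]
    exact hL2.mono_set hsub
  have hgn : IntervalIntegrable (fun t ↦ ‖f t‖) volume a x := by
    rw [intervalIntegrable_iff_integrableOn_Ioo_of_le hax.le]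
    exact (integrableOn_norm_of_sq hfm hL2).mono_set hsub
  calc ∫ t in a..x, ‖f t‖ ≤ ∫ t in a..x, (δ + ‖f t‖ ^ 2 / δ) / 2 := by
        refine intervalIntegral.integral_mono_on hax.le hgn ?_ fun t _ ↦ le_half_add_sq_div' _ hδ0
        exact (intervalIntegrable_const.add (hL2x.div_const δ)).div_const 2
    _ = (δ * (x - a) + (∫ t in a..x, ‖f t‖ ^ 2) / δ) / 2 := by
        rw [intervalIntegral.integral_div, intervalIntegral.integral_add intervalIntegrable_const
          (hL2x.div_const δ), intervalIntegral.integral_const, intervalIntegral.integral_div,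
          smul_eq_mul]
        ring
    _ ≤ (δ * (x - a) + N / δ) / 2 := by
        gcongr
        rw [intervalIntegral.integral_of_le hax.le, hN]
        calc ∫ t in Ioc a x, ‖f t‖ ^ 2 = ∫ t in Ioo a x, ‖f t‖ ^ 2 :=
              setIntegral_congr_set Ioo_ae_eq_Ioc.symm
          _ ≤ ∫ t in Ioo a b, ‖f t‖ ^ 2 :=
            setIntegral_mono_set hL2 (ae_of_all _ fun t ↦ by positivity) (ae_of_all _ hsub)
    _ = (1 + N) / 2 * Real.sqrt (x - a) := by
        have h1 : δ * (x - a) = Real.sqrt (x - a) := by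
          rw [hδ, inv_mul_eq_div, div_eq_iff hsqrt.ne', Real.mul_self_sqrt hxa.le]
        have h2 : N / δ = N * Real.sqrt (x - a) := by rw [hδ, div_inv_eq_mul]
        rw [h1, h2]; ring

/-- Mirror image: `∫_x^b ‖f‖ ≤ (1 + ‖f‖²_{L²(a,b)})/2 · √(b − x)`.
[cite: ConnesMoscovici2022, proof of Lemma 1.2 (= arXiv Lemma 2.2, chunk p0004:L72–L74)] -/
theorem intervalIntegral_norm_le_sqrt' (hfm : AEStronglyMeasurable f (volume.restrict (Ioo a b)))
    (hL2 : IntegrableOn (fun x ↦ ‖f x‖ ^ 2) (Ioo a b)) {x : ℝ} (hx : x ∈ Ioo a b) :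
    ∫ t in x..b, ‖f t‖ ≤ (1 + ∫ t in Ioo a b, ‖f t‖ ^ 2) / 2 * Real.sqrt (b - x) := by
  have hxb : x < b := hx.2
  have hbx : 0 < b - x := sub_pos.2 hxb
  set N : ℝ := ∫ t in Ioo a b, ‖f t‖ ^ 2 with hN
  have hN0 : 0 ≤ N := setIntegral_nonneg measurableSet_Ioo fun t _ ↦ by positivity
  set δ : ℝ := (Real.sqrt (b - x))⁻¹ with hδ
  have hsqrt : 0 < Real.sqrt (b - x) := Real.sqrt_pos.2 hbx
  have hδ0 : 0 < δ := inv_pos.2 hsqrt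
  have hsub : Ioo x b ⊆ Ioo a b := Ioo_subset_Ioo_left hx.1.le
  have hL2x : IntervalIntegrable (fun t ↦ ‖f t‖ ^ 2) volume x b := by
    rw [intervalIntegrable_iff_integrableOn_Ioo_of_le hxb.le]
    exact hL2.mono_set hsub
  have hgn : IntervalIntegrable (fun t ↦ ‖f t‖) volume x b := by
    rw [intervalIntegrable_iff_integrableOn_Ioo_of_le hxb.le]
    exact (integrableOn_norm_of_sq hfm hL2).mono_set hsub
  calc ∫ t in x..b, ‖f t‖ ≤ ∫ t in x..b, (δ + ‖f t‖ ^ 2 / δ) / 2 := by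
        refine intervalIntegral.integral_mono_on hxb.le hgn ?_ fun t _ ↦ le_half_add_sq_div' _ hδ0
        exact (intervalIntegrable_const.add (hL2x.div_const δ)).div_const 2
    _ = (δ * (b - x) + (∫ t in x..b, ‖f t‖ ^ 2) / δ) / 2 := by
        rw [intervalIntegral.integral_div, intervalIntegral.integral_add intervalIntegrable_const
          (hL2x.div_const δ), intervalIntegral.integral_const, intervalIntegral.integral_div,
          smul_eq_mul]
        ring
    _ ≤ (δ * (b - x) + N / δ) / 2 := by
        gcongr
        rw [intervalIntegral.integral_of_le hxb.le, hN]
        calc ∫ t in Ioc x b, ‖f t‖ ^ 2 = ∫ t in Ioo x b, ‖f t‖ ^ 2 :=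
              setIntegral_congr_set Ioo_ae_eq_Ioc.symm
          _ ≤ ∫ t in Ioo a b, ‖f t‖ ^ 2 :=
            setIntegral_mono_set hL2 (ae_of_all _ fun t ↦ by positivity) (ae_of_all _ hsub)
    _ = (1 + N) / 2 * Real.sqrt (b - x) := by
        have h1 : δ * (b - x) = Real.sqrt (b - x) := by
          rw [hδ, inv_mul_eq_div, div_eq_iff hsqrt.ne', Real.mul_self_sqrt hbx.le]
        have h2 : N / δ = N * Real.sqrt (b - x) := by rw [hδ, div_inv_eq_mul]
        rw [h1, h2]; ring

end SqrtBound

/-! ## §B. A `C¹` function with `‖g′‖ ≤ C/√(dist to endpoint)` has a limit at the endpoint -/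

section DerivBound

variable {a b C : ℝ} {g : ℝ → ℂ}

/-- RH-FREE (PROVED). If `g ∈ C¹(a,b)` and `‖g′(x)‖ ≤ C/√(x − a)` on `(a,b)`, then `g` has a limit at
`a⁺` (`g′` is integrable on `(a,b)`, so `g = g(x₁) + ∫_{x₁} g′` extends continuously).
[cite: ConnesMoscovici2022, Cor 1.7 (i) (= arXiv Cor 2.7, chunk p0006:L116–L123)] -/
theorem exists_tendsto_nhdsGT_of_norm_deriv_le (hab : a < b) (hg : ContDiffOn ℝ 1 g (Ioo a b))
    (hd : ∀ x ∈ Ioo a b, ‖deriv g x‖ ≤ C * (Real.sqrt (x - a))⁻¹) :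
    ∃ c : ℂ, Tendsto g (𝓝[>] a) (𝓝 c) := by
  have hgd : ∀ x ∈ Ioo a b, HasDerivAt g (deriv g x) x := fun x hx ↦
    ((hg.differentiableOn one_ne_zero x hx).differentiableAt (Ioo_mem_nhds hx.1 hx.2)).hasDerivAt
  have hg'c : ContinuousOn (deriv g) (Ioo a b) := hg.continuousOn_deriv_of_isOpen isOpen_Ioo le_rfl
  -- `deriv g` is integrable on `(a, b)`
  have hderiv_int : IntegrableOn (deriv g) (Ioo a b) := by
    have hI : IntervalIntegrable (fun t : ℝ ↦ (t - a) ^ (-(1 / 2 : ℝ))) volume a b := by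
      have h := (intervalIntegral.intervalIntegrable_rpow' (a := 0) (b := b - a)
        (by norm_num : (-1 : ℝ) < -(1 / 2))).comp_sub_right a
      simpa using h
    have hB : IntegrableOn (fun t : ℝ ↦ C * (t - a) ^ (-(1 / 2 : ℝ))) (Ioo a b) :=
      (hI.1.mono_set Ioo_subset_Ioc_self).const_mul C
    refine Integrable.mono' hB (hg'c.aestronglyMeasurable measurableSet_Ioo) ?_
    rw [ae_restrict_iff' measurableSet_Ioo]
    refine ae_of_all _ fun t ht ↦ ?_
    have hta : 0 < t - a := sub_pos.2 ht.1
    have := hd t ht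
    rwa [Real.sqrt_eq_rpow, ← Real.rpow_neg hta.le] at this
  -- `g = g(x₁) + ∫_{x₁} g′` near `a⁺`, with the primitive of the zero extension continuous
  set G : ℝ → ℂ := (Ioo a b).indicator (deriv g) with hG
  have hGint : Integrable G := (integrable_indicator_iff measurableSet_Ioo).2 hderiv_int
  set x₁ : ℝ := (a + b) / 2 with hx₁
  have hx₁m : x₁ ∈ Ioo a b := ⟨left_lt_add_div_two.2 hab, add_div_two_lt_right.2 hab⟩
  have hΦ : Continuous fun x ↦ ∫ t in x₁..x, G t :=
    continuous_primitive (fun _ _ ↦ hGint.intervalIntegrable) x₁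
  have hrepr : ∀ x ∈ Ioo a x₁, g x = g x₁ + ∫ t in x₁..x, G t := by
    intro x hx
    have hsub : uIcc x x₁ ⊆ Ioo a b := by
      rw [uIcc_of_le hx.2.le]; exact fun t ht ↦ ⟨hx.1.trans_le ht.1, ht.2.trans_lt hx₁m.2⟩
    have hFTC : ∫ t in x..x₁, deriv g t = g x₁ - g x :=
      integral_eq_sub_of_hasDerivAt (fun t ht ↦ hgd t (hsub ht))
        ((hg'c.mono hsub).intervalIntegrable)
    have hcongr : ∫ t in x..x₁, G t = ∫ t in x..x₁, deriv g t :=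
      intervalIntegral.integral_congr fun t ht ↦ by rw [hG, indicator_of_mem (hsub ht)]
    rw [intervalIntegral.integral_symm, hcongr, hFTC]
    ring
  refine ⟨g x₁ + ∫ t in x₁..a, G t, ?_⟩
  have hlim : Tendsto (fun x ↦ g x₁ + ∫ t in x₁..x, G t) (𝓝[>] a)
      (𝓝 (g x₁ + ∫ t in x₁..a, G t)) :=
    ((continuous_const.add hΦ).tendsto a).mono_left nhdsWithin_le_nhds
  refine hlim.congr' ?_
  filter_upwards [Ioo_mem_nhdsGT hx₁m.1] with x hx
  exact (hrepr x hx).symm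

/-- RH-FREE (PROVED). Mirror image: `‖g′(x)‖ ≤ C/√(b − x)` on `(a,b)` gives a limit of `g` at `b⁻`.
[cite: ConnesMoscovici2022, Cor 1.7 (i) (= arXiv Cor 2.7, chunk p0006:L116–L123)] -/
theorem exists_tendsto_nhdsLT_of_norm_deriv_le (hab : a < b) (hg : ContDiffOn ℝ 1 g (Ioo a b))
    (hd : ∀ x ∈ Ioo a b, ‖deriv g x‖ ≤ C * (Real.sqrt (b - x))⁻¹) :
    ∃ c : ℂ, Tendsto g (𝓝[<] b) (𝓝 c) := by
  have hgd : ∀ x ∈ Ioo a b, HasDerivAt g (deriv g x) x := fun x hx ↦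
    ((hg.differentiableOn one_ne_zero x hx).differentiableAt (Ioo_mem_nhds hx.1 hx.2)).hasDerivAt
  have hg'c : ContinuousOn (deriv g) (Ioo a b) := hg.continuousOn_deriv_of_isOpen isOpen_Ioo le_rfl
  have hderiv_int : IntegrableOn (deriv g) (Ioo a b) := by
    have hI : IntervalIntegrable (fun t : ℝ ↦ (b - t) ^ (-(1 / 2 : ℝ))) volume a b := by
      have h := (intervalIntegral.intervalIntegrable_rpow' (a := 0) (b := b - a)
        (by norm_num : (-1 : ℝ) < -(1 / 2))).comp_sub_left b
      simp only [sub_zero, sub_sub_cancel] at h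
      exact h.symm
    have hB : IntegrableOn (fun t : ℝ ↦ C * (b - t) ^ (-(1 / 2 : ℝ))) (Ioo a b) :=
      (hI.1.mono_set Ioo_subset_Ioc_self).const_mul C
    refine Integrable.mono' hB (hg'c.aestronglyMeasurable measurableSet_Ioo) ?_
    rw [ae_restrict_iff' measurableSet_Ioo]
    refine ae_of_all _ fun t ht ↦ ?_
    have htb : 0 < b - t := sub_pos.2 ht.2
    have := hd t ht
    rwa [Real.sqrt_eq_rpow, ← Real.rpow_neg htb.le] at this
  set G : ℝ → ℂ := (Ioo a b).indicator (deriv g) with hG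
  have hGint : Integrable G := (integrable_indicator_iff measurableSet_Ioo).2 hderiv_int
  set x₁ : ℝ := (a + b) / 2 with hx₁
  have hx₁m : x₁ ∈ Ioo a b := ⟨left_lt_add_div_two.2 hab, add_div_two_lt_right.2 hab⟩
  have hΦ : Continuous fun x ↦ ∫ t in x₁..x, G t :=
    continuous_primitive (fun _ _ ↦ hGint.intervalIntegrable) x₁
  have hrepr : ∀ x ∈ Ioo x₁ b, g x = g x₁ + ∫ t in x₁..x, G t := by
    intro x hx
    have hsub : uIcc x₁ x ⊆ Ioo a b := by
      rw [uIcc_of_le hx.1.le]; exact fun t ht ↦ ⟨hx₁m.1.trans_le ht.1, ht.2.trans_lt hx.2⟩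
    have hFTC : ∫ t in x₁..x, deriv g t = g x - g x₁ :=
      integral_eq_sub_of_hasDerivAt (fun t ht ↦ hgd t (hsub ht))
        ((hg'c.mono hsub).intervalIntegrable)
    have hcongr : ∫ t in x₁..x, G t = ∫ t in x₁..x, deriv g t :=
      intervalIntegral.integral_congr fun t ht ↦ by rw [hG, indicator_of_mem (hsub ht)]
    rw [hcongr, hFTC]
    ring
  refine ⟨g x₁ + ∫ t in x₁..b, G t, ?_⟩
  have hlim : Tendsto (fun x ↦ g x₁ + ∫ t in x₁..x, G t) (𝓝[<] b)
      (𝓝 (g x₁ + ∫ t in x₁..b, G t)) :=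
    ((continuous_const.add hΦ).tendsto b).mono_left nhdsWithin_le_nhds
  refine hlim.congr' ?_
  filter_upwards [Ioo_mem_nhdsLT hx₁m.2] with x hx
  exact (hrepr x hx).symm

end DerivBound

/-! ## §C. FTC form of `(p g′)′ = f`, `f ∈ L²`, plus the boundary condition `p g′ → 0` -/

section FTC

variable {a b m : ℝ} {g p f : ℝ → ℂ}

/-- RH-FREE (PROVED). **One-sided limit at a regular singular endpoint, inhomogeneous version
(right of `a`).**  Let `g ∈ C¹(a,b)`, `p(y)g′(y) − p(x)g′(x) = ∫_x^y f` for `a < x ≤ y < b` with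
`f ∈ L²(a,b)`, `‖p(x)‖ ≥ m(x − a)` (`m > 0`) and `p g′ → 0` at `a⁺` (the boundary condition (1.19)).
Then `g` has a limit at `a⁺`: `p g′(x) = ∫_a^x f = O(√(x−a))`, so `g′ = O((x−a)^{-1/2})` is integrable.
[cite: ConnesMoscovici2022, Cor 1.7 (i) and proof of Lemma 1.2 (= arXiv Cor 2.7 / Lemma 2.2, chunks p0006:L116–L123, p0004:L72–L90)] -/
theorem exists_tendsto_nhdsGT_of_ftc (hab : a < b) (hm : 0 < m) (hg : ContDiffOn ℝ 1 g (Ioo a b))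
    (hftc : ∀ x y, a < x → x ≤ y → y < b → p y * deriv g y - p x * deriv g x = ∫ t in x..y, f t)
    (hfm : AEStronglyMeasurable f (volume.restrict (Ioo a b)))
    (hL2 : IntegrableOn (fun x ↦ ‖f x‖ ^ 2) (Ioo a b))
    (hp : ∀ x ∈ Ioo a b, m * (x - a) ≤ ‖p x‖)
    (hbc : Tendsto (fun x ↦ p x * deriv g x) (𝓝[>] a) (𝓝 0)) :
    ∃ c : ℂ, Tendsto g (𝓝[>] a) (𝓝 c) := by
  set u : ℝ → ℂ := fun y ↦ p y * deriv g y with hu_def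
  set N : ℝ := ∫ t in Ioo a b, ‖f t‖ ^ 2 with hN
  have hN0 : 0 ≤ N := setIntegral_nonneg measurableSet_Ioo fun t _ ↦ by positivity
  have hfi : IntegrableOn (fun t ↦ ‖f t‖) (Ioo a b) := integrableOn_norm_of_sq hfm hL2
  have hfn_int : ∀ x ∈ Ioo a b, IntervalIntegrable (fun t ↦ ‖f t‖) volume a x := by
    intro x hx
    rw [intervalIntegrable_iff_integrableOn_Ioo_of_le hx.1.le]
    exact hfi.mono_set (Ioo_subset_Ioo_right hx.2.le)
  -- Step 1: `‖u x‖ ≤ ∫_a^x ‖f‖`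
  have hu_bound : ∀ x ∈ Ioo a b, ‖u x‖ ≤ ∫ t in a..x, ‖f t‖ := by
    intro x hx
    have hK : ∀ y ∈ Ioo a x, ‖u x‖ ≤ ‖u y‖ + ∫ t in a..x, ‖f t‖ := by
      intro y hy
      have hyb : y < b := hy.2.trans hx.2
      have h1 : ‖u x - u y‖ ≤ ∫ t in y..x, ‖f t‖ := by
        rw [hu_def]; dsimp only
        rw [hftc y x hy.1 hy.2.le hx.2]
        exact norm_integral_le_integral_norm hy.2.le
      have h2 : ∫ t in y..x, ‖f t‖ ≤ ∫ t in a..x, ‖f t‖ := by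
        have hi1 : IntervalIntegrable (fun t ↦ ‖f t‖) volume a y :=
          (hfn_int x hx).mono_set (by
            rw [uIcc_of_le hy.1.le, uIcc_of_le hx.1.le]; exact Icc_subset_Icc le_rfl hy.2.le)
        have hi2 : IntervalIntegrable (fun t ↦ ‖f t‖) volume y x :=
          (hfn_int x hx).mono_set (by
            rw [uIcc_of_le hy.2.le, uIcc_of_le hx.1.le]; exact Icc_subset_Icc hy.1.le le_rfl)
        have hadd := intervalIntegral.integral_add_adjacent_intervals hi1 hi2
        have h0 : 0 ≤ ∫ t in a..y, ‖f t‖ :=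
          intervalIntegral.integral_nonneg hy.1.le fun t _ ↦ norm_nonneg _
        linarith
      calc ‖u x‖ = ‖u y + (u x - u y)‖ := by ring_nf
        _ ≤ ‖u y‖ + ‖u x - u y‖ := norm_add_le _ _
        _ ≤ ‖u y‖ + ∫ t in a..x, ‖f t‖ := by gcongr; exact h1.trans h2
    have hlim : Tendsto (fun y ↦ ‖u y‖ + ∫ t in a..x, ‖f t‖) (𝓝[>] a)
        (𝓝 (0 + ∫ t in a..x, ‖f t‖)) :=
      (tendsto_norm_zero.comp hbc).add tendsto_const_nhds
    rw [zero_add] at hlim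
    exact ge_of_tendsto hlim (mem_of_superset (Ioo_mem_nhdsGT hx.1) fun y hy ↦ hK y hy)
  -- Step 2: `‖g′ x‖ ≤ C/√(x − a)`
  set C : ℝ := ((1 + N) / 2) / m with hC
  have hderiv_bound : ∀ x ∈ Ioo a b, ‖deriv g x‖ ≤ C * (Real.sqrt (x - a))⁻¹ := by
    intro x hx
    have hxa : 0 < x - a := sub_pos.2 hx.1
    have hsqrt : 0 < Real.sqrt (x - a) := Real.sqrt_pos.2 hxa
    have h1 : ‖u x‖ ≤ (1 + N) / 2 * Real.sqrt (x - a) :=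
      (hu_bound x hx).trans (intervalIntegral_norm_le_sqrt hfm hL2 hx)
    have h2 : m * (x - a) * ‖deriv g x‖ ≤ ‖u x‖ := by
      rw [hu_def]; dsimp only; rw [norm_mul]
      exact mul_le_mul_of_nonneg_right (hp x hx) (norm_nonneg _)
    have hpos : 0 < m * (x - a) := mul_pos hm hxa
    have h3 : ‖deriv g x‖ ≤ (1 + N) / 2 * Real.sqrt (x - a) / (m * (x - a)) := by
      rw [le_div_iff₀ hpos]
      calc ‖deriv g x‖ * (m * (x - a)) = m * (x - a) * ‖deriv g x‖ := by ring
        _ ≤ _ := h2.trans h1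
    refine h3.trans (le_of_eq ?_)
    rw [hC]
    set s : ℝ := Real.sqrt (x - a) with hs_def
    have hs : s * s = x - a := Real.mul_self_sqrt hxa.le
    have hs0 : s ≠ 0 := hsqrt.ne'
    have hm0 : m ≠ 0 := hm.ne'
    rw [← hs]
    field_simp
  exact exists_tendsto_nhdsGT_of_norm_deriv_le hab hg hderiv_bound

/-- RH-FREE (PROVED). **Inhomogeneous one-sided limit, left of `b`**: `‖p(x)‖ ≥ m(b − x)` and
`p g′ → 0` at `b⁻` give a limit of `g` at `b⁻`.
[cite: ConnesMoscovici2022, Cor 1.7 (i) and proof of Lemma 1.2 (= arXiv Cor 2.7 / Lemma 2.2, chunks p0006:L116–L123, p0004:L72–L90)] -/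
theorem exists_tendsto_nhdsLT_of_ftc (hab : a < b) (hm : 0 < m) (hg : ContDiffOn ℝ 1 g (Ioo a b))
    (hftc : ∀ x y, a < x → x ≤ y → y < b → p y * deriv g y - p x * deriv g x = ∫ t in x..y, f t)
    (hfm : AEStronglyMeasurable f (volume.restrict (Ioo a b)))
    (hL2 : IntegrableOn (fun x ↦ ‖f x‖ ^ 2) (Ioo a b))
    (hp : ∀ x ∈ Ioo a b, m * (b - x) ≤ ‖p x‖)
    (hbc : Tendsto (fun x ↦ p x * deriv g x) (𝓝[<] b) (𝓝 0)) :
    ∃ c : ℂ, Tendsto g (𝓝[<] b) (𝓝 c) := by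
  set u : ℝ → ℂ := fun y ↦ p y * deriv g y with hu_def
  set N : ℝ := ∫ t in Ioo a b, ‖f t‖ ^ 2 with hN
  have hN0 : 0 ≤ N := setIntegral_nonneg measurableSet_Ioo fun t _ ↦ by positivity
  have hfi : IntegrableOn (fun t ↦ ‖f t‖) (Ioo a b) := integrableOn_norm_of_sq hfm hL2
  have hfn_int : ∀ x ∈ Ioo a b, IntervalIntegrable (fun t ↦ ‖f t‖) volume x b := by
    intro x hx
    rw [intervalIntegrable_iff_integrableOn_Ioo_of_le hx.2.le]
    exact hfi.mono_set (Ioo_subset_Ioo_left hx.1.le)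
  -- Step 1: `‖u x‖ ≤ ∫_x^b ‖f‖`
  have hu_bound : ∀ x ∈ Ioo a b, ‖u x‖ ≤ ∫ t in x..b, ‖f t‖ := by
    intro x hx
    have hK : ∀ y ∈ Ioo x b, ‖u x‖ ≤ ‖u y‖ + ∫ t in x..b, ‖f t‖ := by
      intro y hy
      have hay : a < y := hx.1.trans hy.1
      have h1 : ‖u y - u x‖ ≤ ∫ t in x..y, ‖f t‖ := by
        rw [hu_def]; dsimp only
        rw [hftc x y hx.1 hy.1.le hy.2]
        exact norm_integral_le_integral_norm hy.1.le
      have h2 : ∫ t in x..y, ‖f t‖ ≤ ∫ t in x..b, ‖f t‖ := by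
        have hi1 : IntervalIntegrable (fun t ↦ ‖f t‖) volume x y :=
          (hfn_int x hx).mono_set (by
            rw [uIcc_of_le hy.1.le, uIcc_of_le hx.2.le]; exact Icc_subset_Icc le_rfl hy.2.le)
        have hi2 : IntervalIntegrable (fun t ↦ ‖f t‖) volume y b :=
          (hfn_int x hx).mono_set (by
            rw [uIcc_of_le hy.2.le, uIcc_of_le hx.2.le]; exact Icc_subset_Icc hy.1.le le_rfl)
        have hadd := intervalIntegral.integral_add_adjacent_intervals hi1 hi2
        have h0 : 0 ≤ ∫ t in y..b, ‖f t‖ :=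
          intervalIntegral.integral_nonneg hy.2.le fun t _ ↦ norm_nonneg _
        linarith
      calc ‖u x‖ = ‖u y - (u y - u x)‖ := by ring_nf
        _ ≤ ‖u y‖ + ‖u y - u x‖ := norm_sub_le _ _
        _ ≤ ‖u y‖ + ∫ t in x..b, ‖f t‖ := by gcongr; exact h1.trans h2
    have hlim : Tendsto (fun y ↦ ‖u y‖ + ∫ t in x..b, ‖f t‖) (𝓝[<] b)
        (𝓝 (0 + ∫ t in x..b, ‖f t‖)) :=
      (tendsto_norm_zero.comp hbc).add tendsto_const_nhds
    rw [zero_add] at hlim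
    exact ge_of_tendsto hlim (mem_of_superset (Ioo_mem_nhdsLT hx.2) fun y hy ↦ hK y hy)
  -- Step 2: `‖g′ x‖ ≤ C/√(b − x)`
  set C : ℝ := ((1 + N) / 2) / m with hC
  have hderiv_bound : ∀ x ∈ Ioo a b, ‖deriv g x‖ ≤ C * (Real.sqrt (b - x))⁻¹ := by
    intro x hx
    have hbx : 0 < b - x := sub_pos.2 hx.2
    have hsqrt : 0 < Real.sqrt (b - x) := Real.sqrt_pos.2 hbx
    have h1 : ‖u x‖ ≤ (1 + N) / 2 * Real.sqrt (b - x) :=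
      (hu_bound x hx).trans (intervalIntegral_norm_le_sqrt' hfm hL2 hx)
    have h2 : m * (b - x) * ‖deriv g x‖ ≤ ‖u x‖ := by
      rw [hu_def]; dsimp only; rw [norm_mul]
      exact mul_le_mul_of_nonneg_right (hp x hx) (norm_nonneg _)
    have hpos : 0 < m * (b - x) := mul_pos hm hbx
    have h3 : ‖deriv g x‖ ≤ (1 + N) / 2 * Real.sqrt (b - x) / (m * (b - x)) := by
      rw [le_div_iff₀ hpos]
      calc ‖deriv g x‖ * (m * (b - x)) = m * (b - x) * ‖deriv g x‖ := by ring
        _ ≤ _ := h2.trans h1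
    refine h3.trans (le_of_eq ?_)
    rw [hC]
    set s : ℝ := Real.sqrt (b - x) with hs_def
    have hs : s * s = b - x := Real.mul_self_sqrt hbx.le
    have hs0 : s ≠ 0 := hsqrt.ne'
    have hm0 : m ≠ 0 := hm.ne'
    rw [← hs]
    field_simp
  exact exists_tendsto_nhdsLT_of_norm_deriv_le hab hg hderiv_bound

end FTC

/-! ## §D. The four sides of `±λ` for `p = λ² − x²`, `f = q g − η` (`g =ᵐ ξ ∈ L²`, `η ∈ L²`) -/

section Prolate

variable {lam : ℝ}

/-- `‖a − b‖² ≤ 2‖a‖² + 2‖b‖²`. [folklore] -/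
private theorem norm_sub_sq_le' (a b : ℂ) : ‖a - b‖ ^ 2 ≤ 2 * ‖a‖ ^ 2 + 2 * ‖b‖ ^ 2 := by
  have h := norm_sub_le a b
  nlinarith [norm_nonneg (a - b), norm_nonneg a, norm_nonneg b, sq_nonneg (‖a‖ - ‖b‖)]

/-- `f = q g − η` is a.e.-measurable and square integrable on a bounded interval inside `|x| ≤ 2λ`
(`g =ᵐ ξ ∈ L²`, `η ∈ L²`, `|q| ≤ (2πλ)²(2λ)²` there). [folklore] -/
private theorem aesm_and_sq_integrable (ξ η : L2R) {g : ℝ → ℂ} (hae : ((ξ : ℝ → ℂ)) =ᵐ[volume] g)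
    {a b : ℝ} (hR : ∀ x ∈ Ioo a b, |x| ≤ 2 * |lam|) :
    AEStronglyMeasurable (fun t ↦ qCoeff lam t * g t - η t) (volume.restrict (Ioo a b)) ∧
      IntegrableOn (fun t ↦ ‖qCoeff lam t * g t - η t‖ ^ 2) (Ioo a b) := by
  have hq : Continuous (qCoeff lam) := by unfold qCoeff; fun_prop
  have hgm : AEStronglyMeasurable g volume := (Lp.aestronglyMeasurable ξ).congr hae
  have hηm : AEStronglyMeasurable (η : ℝ → ℂ) volume := Lp.aestronglyMeasurable η
  have hfm : AEStronglyMeasurable (fun t ↦ qCoeff lam t * g t - η t) volume :=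
    (hq.aestronglyMeasurable.mul hgm).sub hηm
  refine ⟨hfm.restrict, ?_⟩
  -- square integrability of `g` and `η`
  have hξ2 : Integrable (fun t ↦ ‖(ξ : ℝ → ℂ) t‖ ^ 2) :=
    (memLp_two_iff_integrable_sq_norm (Lp.aestronglyMeasurable ξ)).1 (Lp.memLp ξ)
  have hg2 : Integrable (fun t ↦ ‖g t‖ ^ 2) :=
    hξ2.congr (by filter_upwards [hae] with t ht; rw [ht])
  have hη2 : Integrable (fun t ↦ ‖(η : ℝ → ℂ) t‖ ^ 2) :=
    (memLp_two_iff_integrable_sq_norm (Lp.aestronglyMeasurable η)).1 (Lp.memLp η)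
  set Q : ℝ := (2 * π * lam) ^ 2 * (2 * |lam|) ^ 2 with hQ
  have hqb : ∀ x ∈ Ioo a b, ‖qCoeff lam x‖ ≤ Q := by
    intro x hx
    rw [qCoeff, Complex.norm_real, Real.norm_eq_abs, abs_of_nonneg (by positivity), hQ]
    have h1 : x ^ 2 ≤ (2 * |lam|) ^ 2 := by
      rw [← sq_abs x]; exact pow_le_pow_left₀ (abs_nonneg x) (hR x hx) 2
    exact mul_le_mul_of_nonneg_left h1 (by positivity)
  have hdom : IntegrableOn (fun t ↦ 2 * (Q ^ 2 * ‖g t‖ ^ 2) + 2 * ‖(η : ℝ → ℂ) t‖ ^ 2) (Ioo a b) :=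
    (((hg2.const_mul (Q ^ 2)).const_mul 2).add (hη2.const_mul 2)).integrableOn
  refine Integrable.mono' hdom (hfm.norm.pow 2).restrict ?_
  rw [ae_restrict_iff' measurableSet_Ioo]
  refine ae_of_all _ fun t ht ↦ ?_
  rw [Real.norm_eq_abs, abs_of_nonneg (by positivity)]
  have h1 := norm_sub_sq_le' (qCoeff lam t * g t) (η t)
  have h2 : ‖qCoeff lam t * g t‖ ^ 2 ≤ Q ^ 2 * ‖g t‖ ^ 2 := by
    rw [norm_mul, mul_pow]
    exact mul_le_mul_of_nonneg_right
      (pow_le_pow_left₀ (norm_nonneg _) (hqb t ht) 2) (by positivity)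
  linarith

/-- `‖p(x)‖ = |λ² − x²|`. [folklore] -/
private theorem norm_pCoeff (lam x : ℝ) : ‖pCoeff lam x‖ = |lam ^ 2 - x ^ 2| := by
  rw [pCoeff, Complex.norm_real, Real.norm_eq_abs]

/-- RH-FREE (PROVED). **Limit at `λ⁺` under (1.19).**  Let `g` be a representative of `ξ ∈ L²(ℝ)`,
`C¹` off `±λ`, with `p g′` a primitive of `q g − η` on each component (`η ∈ L²(ℝ)`; the shape of
`UVProlateMaxDomainRegularity.exists_regular_repr` for `ξ ∈ dom W_max`, `η = W_max ξ`).  If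
`p g′ → 0` at `λ⁺`, then `g` has a limit at `λ⁺`.
[cite: ConnesMoscovici2022, Cor 1.7 (i) and (1.19) (= arXiv Cor 2.7 / (2.19), chunks p0006:L116–L123, p0006:L55–L60)] -/
theorem exists_tendsto_right_lam_of_ftc (hlam : 0 < lam) (ξ η : L2R) {g : ℝ → ℂ}
    (hae : ((ξ : ℝ → ℂ)) =ᵐ[volume] g) (hg : ContDiffOn ℝ 1 g {x | x ≠ lam ∧ x ≠ -lam})
    (hftc : ∀ x y, x ≤ y → Icc x y ⊆ {x | x ≠ lam ∧ x ≠ -lam} →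
      pCoeff lam y * deriv g y - pCoeff lam x * deriv g x =
        ∫ t in x..y, (qCoeff lam t * g t - η t))
    (hbc : Tendsto (fun x ↦ pCoeff lam x * deriv g x) (𝓝[>] lam) (𝓝 0)) :
    ∃ c : ℂ, Tendsto g (𝓝[>] lam) (𝓝 c) := by
  have hsub : Ioo lam (2 * lam) ⊆ {x | x ≠ lam ∧ x ≠ -lam} :=
    fun x hx ↦ ⟨hx.1.ne', by linarith [hx.1]⟩
  obtain ⟨hfm, hL2⟩ := aesm_and_sq_integrable (lam := lam) ξ η hae (a := lam) (b := 2 * lam)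
    (fun x hx ↦ by rw [abs_of_pos (hlam.trans hx.1), abs_of_pos hlam]; linarith [hx.2])
  refine exists_tendsto_nhdsGT_of_ftc (by linarith) (by positivity : (0:ℝ) < 2 * lam)
    (hg.mono hsub) (fun x y hx hxy hy ↦ hftc x y hxy fun t ht ↦
      hsub ⟨lt_of_lt_of_le hx ht.1, lt_of_le_of_lt ht.2 hy⟩) hfm hL2 (fun x hx ↦ ?_) hbc
  rw [norm_pCoeff, abs_of_nonpos (by nlinarith [hx.1, hx.2])]
  nlinarith [hx.1, hx.2]

/-- RH-FREE (PROVED). **Limit at `λ⁻` under (1.19)** (same setting, `p g′ → 0` at `λ⁻`).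
[cite: ConnesMoscovici2022, Cor 1.7 (i) and (1.19) (= arXiv Cor 2.7 / (2.19), chunks p0006:L116–L123, p0006:L55–L60)] -/
theorem exists_tendsto_left_lam_of_ftc (hlam : 0 < lam) (ξ η : L2R) {g : ℝ → ℂ}
    (hae : ((ξ : ℝ → ℂ)) =ᵐ[volume] g) (hg : ContDiffOn ℝ 1 g {x | x ≠ lam ∧ x ≠ -lam})
    (hftc : ∀ x y, x ≤ y → Icc x y ⊆ {x | x ≠ lam ∧ x ≠ -lam} →
      pCoeff lam y * deriv g y - pCoeff lam x * deriv g x =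
        ∫ t in x..y, (qCoeff lam t * g t - η t))
    (hbc : Tendsto (fun x ↦ pCoeff lam x * deriv g x) (𝓝[<] lam) (𝓝 0)) :
    ∃ c : ℂ, Tendsto g (𝓝[<] lam) (𝓝 c) := by
  have hsub : Ioo 0 lam ⊆ {x | x ≠ lam ∧ x ≠ -lam} :=
    fun x hx ↦ ⟨hx.2.ne, by linarith [hx.1]⟩
  obtain ⟨hfm, hL2⟩ := aesm_and_sq_integrable (lam := lam) ξ η hae (a := 0) (b := lam)
    (fun x hx ↦ by rw [abs_of_pos hx.1, abs_of_pos hlam]; linarith [hx.2])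
  refine exists_tendsto_nhdsLT_of_ftc hlam hlam
    (hg.mono hsub) (fun x y hx hxy hy ↦ hftc x y hxy fun t ht ↦
      hsub ⟨lt_of_lt_of_le hx ht.1, lt_of_le_of_lt ht.2 hy⟩) hfm hL2 (fun x hx ↦ ?_) hbc
  rw [norm_pCoeff, abs_of_nonneg (by nlinarith [hx.1, hx.2])]
  nlinarith [hx.1, hx.2]

/-- RH-FREE (PROVED). **Limit at `(−λ)⁺` under (1.19)** (same setting, `p g′ → 0` at `(−λ)⁺`).
[cite: ConnesMoscovici2022, Cor 1.7 (i) and (1.19) (= arXiv Cor 2.7 / (2.19), chunks p0006:L116–L123, p0006:L55–L60)] -/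
theorem exists_tendsto_right_neg_lam_of_ftc (hlam : 0 < lam) (ξ η : L2R) {g : ℝ → ℂ}
    (hae : ((ξ : ℝ → ℂ)) =ᵐ[volume] g) (hg : ContDiffOn ℝ 1 g {x | x ≠ lam ∧ x ≠ -lam})
    (hftc : ∀ x y, x ≤ y → Icc x y ⊆ {x | x ≠ lam ∧ x ≠ -lam} →
      pCoeff lam y * deriv g y - pCoeff lam x * deriv g x =
        ∫ t in x..y, (qCoeff lam t * g t - η t))
    (hbc : Tendsto (fun x ↦ pCoeff lam x * deriv g x) (𝓝[>] (-lam)) (𝓝 0)) :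
    ∃ c : ℂ, Tendsto g (𝓝[>] (-lam)) (𝓝 c) := by
  have hsub : Ioo (-lam) 0 ⊆ {x | x ≠ lam ∧ x ≠ -lam} :=
    fun x hx ↦ ⟨by linarith [hx.2], hx.1.ne'⟩
  obtain ⟨hfm, hL2⟩ := aesm_and_sq_integrable (lam := lam) ξ η hae (a := -lam) (b := 0)
    (fun x hx ↦ by rw [abs_of_neg hx.2, abs_of_pos hlam]; linarith [hx.1])
  refine exists_tendsto_nhdsGT_of_ftc (by linarith) hlam
    (hg.mono hsub) (fun x y hx hxy hy ↦ hftc x y hxy fun t ht ↦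
      hsub ⟨lt_of_lt_of_le hx ht.1, lt_of_le_of_lt ht.2 hy⟩) hfm hL2 (fun x hx ↦ ?_) hbc
  rw [norm_pCoeff, abs_of_nonneg (by nlinarith [hx.1, hx.2])]
  nlinarith [hx.1, hx.2]

/-- RH-FREE (PROVED). **Limit at `(−λ)⁻` under (1.19)** (same setting, `p g′ → 0` at `(−λ)⁻`).
[cite: ConnesMoscovici2022, Cor 1.7 (i) and (1.19) (= arXiv Cor 2.7 / (2.19), chunks p0006:L116–L123, p0006:L55–L60)] -/
theorem exists_tendsto_left_neg_lam_of_ftc (hlam : 0 < lam) (ξ η : L2R) {g : ℝ → ℂ}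
    (hae : ((ξ : ℝ → ℂ)) =ᵐ[volume] g) (hg : ContDiffOn ℝ 1 g {x | x ≠ lam ∧ x ≠ -lam})
    (hftc : ∀ x y, x ≤ y → Icc x y ⊆ {x | x ≠ lam ∧ x ≠ -lam} →
      pCoeff lam y * deriv g y - pCoeff lam x * deriv g x =
        ∫ t in x..y, (qCoeff lam t * g t - η t))
    (hbc : Tendsto (fun x ↦ pCoeff lam x * deriv g x) (𝓝[<] (-lam)) (𝓝 0)) :
    ∃ c : ℂ, Tendsto g (𝓝[<] (-lam)) (𝓝 c) := by
  have hsub : Ioo (-(2 * lam)) (-lam) ⊆ {x | x ≠ lam ∧ x ≠ -lam} :=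
    fun x hx ↦ ⟨by linarith [hx.2], hx.2.ne⟩
  obtain ⟨hfm, hL2⟩ := aesm_and_sq_integrable (lam := lam) ξ η hae (a := -(2 * lam)) (b := -lam)
    (fun x hx ↦ by rw [abs_of_neg (by linarith [hx.2]), abs_of_pos hlam]; linarith [hx.1])
  refine exists_tendsto_nhdsLT_of_ftc (by linarith) (by positivity : (0:ℝ) < 2 * lam)
    (hg.mono hsub) (fun x y hx hxy hy ↦ hftc x y hxy fun t ht ↦
      hsub ⟨lt_of_lt_of_le hx ht.1, lt_of_le_of_lt ht.2 hy⟩) hfm hL2 (fun x hx ↦ ?_) hbc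
  rw [norm_pCoeff, abs_of_nonpos (by nlinarith [hx.1, hx.2])]
  nlinarith [hx.1, hx.2]

end Prolate

end Literature.NumberTheory.ConnesMoscovici2022
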